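import Summits.BirchSwinnertonDyer.BirchSwinnertonDyer.Theorems.KimAtThreeShallowEqDeepNonAdditiveOfPosition
import Summits.BirchSwinnertonDyer.BirchSwinnertonDyer.Theorems.KimAtThreeFineKatoPositionCrux
import Summits.BirchSwinnertonDyer.BirchSwinnertonDyer.Theorems.KimAtThreeDeepUpperCiteOnly
import Summits.BirchSwinnertonDyer.BirchSwinnertonDyer.Theorems.KimAtThreeKolyvaginInputs
import Literature.NumberTheory.PAdicHodge.DualExpEllipticTowerSelf
import HarnessLib

/-!
# Route `KimAtThreeKolyvagin` (W2): crux 19077 `ShallowEqDeepAtTorsionFree` BY NAME WITHOUT the crux-19560 hypothesis, and the ROUTE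
# LEAF `N11.KimAtThreeRankZeroPUB` BY NAME, FROM the four route leaves, cite facts, the Kato Literature fact, ONE displayed
# Kato-position package hKatoPosʷ and item 20398 (cell `bsd-addord`, seat w2-c4 gen 12; `--supports` 19077, helper)

HONEST FRAMING.  END-TYPE COMPOSITION THEOREMS (no definition, no named fact, no instance, no `sorry`).  Hypotheses: the four route
leaves `SakamotoKolyvaginThree`, `RankEqAnalyticRankLeOne`, `PoitouTateSelmerDuality`, `CarayolLevelEqConductor` (route decls =
held-PUB statements); the five `PAdicHodge` cite facts (S5a) `expStarCoord_eq_zero_iff_kummer`, (S5b)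
`exists_smul_range_expStarCoord_iff_trace_log`, (S5b-tower) `exists_smul_range_expStarCoord_tower_iff_trace_log`, (P123)
`cupLogInjective_and_hasDualExp_of_isDeRham`, (DR) `isDeRham_restrictedRationalTateRep`; for the leaf also the Kato Literature fact
`Kato2004.exists_eulerSystem_definedExpStar_values` (w2-c2 g9); the ONE displayed package hKatoPosʷ (section variable `hKatoPos`, =
the hypothesis of `KimAtThreeShallowEqDeepKatoV2OfPosition.katoV2W_of_katoPosW_of_facts`: Kato 2004 over the DEFINED `exp*` of SOME
generator `d` at every `3`-adic-tower row with a lattice-optimal parametrisation at the conductor, `κK ≠ 0`, the POSITION clause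
`POS(d, κK)`, (RES₀)/(DEF₀), `ZetaBody`); and the route decl `FineKatoTwoExpDefectThree` (item 20398, additive-defect rows, seat acc3).
ALL CONDITIONAL; nothing is closed or booked by this file; BSD is NOT proved by any of this («closes rung W2 of BirchSwinnertonDyer»
only modulo the displayed hypotheses, never summit credit).

WHAT.
* §1 **`shallowEqDeepAtTorsionFree_of_katoPos_of_cites`** — crux 19077 BY NAME ⟸ 4 leaves ∧ 5 cite facts ∧ hKatoPosʷ ∧ item 20398:
  `KimAtThreeShallowEqDeepNonAdditiveOfPosition.shallowEqDeepAtTorsionFree_of_katoPos_of_facts` with its crux-19560 hypothesis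
  DISCHARGED by w2-acc4's `KimAtThreeFineKatoPositionCrux.katoKuriharaPortThreeShared_of_facts_of_katoPos` at hKatoPos₀ := hKatoPosʷ
  restricted to the Kato stratum (the four stratum binders are simply not used) — 19560's residual of record (kim3 LEAD ruling
  2026-08-27) and the shallow rows' residual are ONE statement.
* §2 **`kimAtThreeRankZeroPUB_of_katoPos_of_lit_of_cites`** — the ROUTE LEAF `Summit.BirchSwinnertonDyer.Rank1Residual.Additive.N11.KimAtThreeRankZeroPUB`
  BY NAME ⟸ 4 leaves ∧ 5 cite facts ∧ Kato Literature fact ∧ hKatoPosʷ ∧ item 20398: the route's deciding theorem `closes` fed with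
  w2-c2 / w2-c3's cite-only deep cruxes (`KimAtThreeDeepUpperCiteOnly.deepLower_and_deepUpper_of_lit_of_facts`), §1, and kim3's
  assembly (`KimAtThreeKolyvaginInputs.kimAtThreeRankZeroPUB_of_inputs`, = `kimAtThreeKolyvagin_assembly_proof`).
* (appended) `…_of_four_cites` twins: (S5b) := kim3 g17's `exists_smul_range_expStarCoord_iff_trace_log_of_tower` (p542762) at (S5b-tower).
READING (08-28, W2 — this seat's proposal for the route card): **the whole route `KimAtThreeKolyvagin` now rests on cite facts plus
TWO displayed statements: hKatoPosʷ (= Kato-only block ∧ POS; the Kato-only block is the matter of the typed Literature fact, so the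
ONE non-cite content is POS — the 3-adic position of Kato's generator against the Néron/duality line, i.e. the period comparison of
19077's docstring) and item 20398 (acc3's two-exponent package on the additive-defect rows).**
References: [Kim2025RefinedTNC] Thm. 1.1/1.2; [Kato2004Asterisque] (8.1.3), 8.12, §9.4, 9.7, 6.6 (1), 13.3; [Kato1993LNM1553] II
§1.2.4, 1.2.3, 1.3.5, 1.4.1; [BlochKato1990] §3; [Kim2022StructureSelmer] Thm. 1.9 (6), 3.13; [Sakamoto2024] Thm. 4.4; [MazurRubin2004]
Thm. 4.4.1, 5.2.12; [Carayol1986].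
-/

set_option autoImplicit false

noncomputable section

-- the cell's Theorems namespace `Summit.BirchSwinnertonDyer.BirchSwinnertonDyer.…` repeats the summit name by design (D-0017)
set_option linter.dupNamespace false

open scoped Classical NumberField TensorProduct ContRepresentation Pointwise
open Field ValuativeRel Function IsDedekindDomain NumberField
open WeierstrassCurve Literature.NumberTheory.EllipticCurves Literature.NumberTheory.GaloisRepresentations
  Literature.NumberTheory.GaloisRepresentations.DiscreteGaloisModule Literature.NumberTheory.GaloisCohomology
open Literature.NumberTheory.GaloisRepresentations.PeriodRingData Literature.NumberTheory.PAdicHodge Literature.NumberTheory.EllipticCurves.ModularForms Literature.NumberTheory.EllipticCurves.Rank1Residual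
open Literature.NumberTheory.EllipticCurves.Kato2004 Literature.NumberTheory.EllipticCurves.Kato2004.EulerSystemValues
open Literature.NumberTheory.AdelicBaseChange Literature.NumberTheory.Automorphic
open Summit.BirchSwinnertonDyer.Rank1Residual.GaloisImage Summit.BirchSwinnertonDyer.Rank1Residual.Additive.LocalLog
open Summit.BirchSwinnertonDyer.BirchSwinnertonDyer.Theorems
open Summit.BirchSwinnertonDyer.BirchSwinnertonDyer.Theorems.KimAtThreeFineKatoLevelCompat
open Summit.BirchSwinnertonDyer.BirchSwinnertonDyer.Theorems.KimAtThreeFineKatoPerFactorDefined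
open Summit.BirchSwinnertonDyer.BirchSwinnertonDyer.Theorems.KimAtThreeFineKatoPerFactorDefinedTwist
open Summit.BirchSwinnertonDyer.BirchSwinnertonDyer.Theorems.KimAtThreeDeepLowerExpStarOmega
open Summit.BirchSwinnertonDyer.BirchSwinnertonDyer.Theorems.KimAtThreeDeepLowerExpStarOmegaPlace
open Summit.BirchSwinnertonDyer.BirchSwinnertonDyer.Theorems.KimAtThreeFineKatoPerFactorPlaces
open Summit.BirchSwinnertonDyer.BirchSwinnertonDyer.Theorems.KimAtThreeDeepUpperExpStarFacts
open Summit.BirchSwinnertonDyer.Rank1Residual.GaloisImage.TameLevel (squarefree_cycLevel_zero)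
open Summit.BirchSwinnertonDyer.BirchSwinnertonDyer.Theorems.KimAtThreeSemiLocalTraceDualCyc
open Summit.BirchSwinnertonDyer.BirchSwinnertonDyer.Theorems.KimAtThreeShallowEqDeepTraceDualLattice
open Summit.BirchSwinnertonDyer.BirchSwinnertonDyer.Theorems.KimAtThreeShallowEqDeepWildDifferentLocal
open Summit.BirchSwinnertonDyer.BirchSwinnertonDyer.Theorems.KimAtThreeShallowEqDeepRiderOfWeightedCompat
open Summit.BirchSwinnertonDyer.BirchSwinnertonDyer.Theses.KimAtThreeKolyvagin
open Summit.BirchSwinnertonDyer.BirchSwinnertonDyer.Theorems.KimAtThreeShallowEqDeepNonAdditiveOfFineKato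
  (hasGoodReductionAtPrime_three_of_not_dvd_conductorNorm)
open Summit.BirchSwinnertonDyer.BirchSwinnertonDyer.Theorems.KimAtThreeShallowEqDeepSplitGlueNoStub
  (shallowEqDeepAtTorsionFree_of_parts_noStub)
open Summit.BirchSwinnertonDyer.BirchSwinnertonDyer.Theorems.KimAtThreeShallowEqDeepWeightedItems
open Summit.BirchSwinnertonDyer.BirchSwinnertonDyer.Theorems.KimAtThreeShallowEqDeepWeightedOfKatoV2
  (definedKatoWeighted_of_katoV2_of_facts)
open Summit.BirchSwinnertonDyer.BirchSwinnertonDyer.Theorems.KimAtThreeShallowEqDeepGoodOfDefinedKato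
  (fineKatoτ_of_definedKatoTwist)
open Summit.BirchSwinnertonDyer.BirchSwinnertonDyer.Theorems.KimAtThreeShallowEqDeepNonAdditiveOfKatoV2
open Summit.BirchSwinnertonDyer.BirchSwinnertonDyer.Theorems.KimAtThreeShallowEqDeepKatoV2OfPosition
open Summit.BirchSwinnertonDyer.BirchSwinnertonDyer.Theorems.KimAtThreeShallowEqDeepNonAdditiveOfPosition
open Summit.BirchSwinnertonDyer.BirchSwinnertonDyer.Theorems.KimAtThreeFineKatoPositionCrux
  (katoKuriharaPortThreeShared_of_facts_of_katoPos)
open Summit.BirchSwinnertonDyer.BirchSwinnertonDyer.Theorems.KimAtThreeDeepUpperCiteOnly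
  (deepLower_and_deepUpper_of_lit_of_facts)

namespace Summit.BirchSwinnertonDyer.BirchSwinnertonDyer.Theorems.KimAtThreeShallowEqDeepRouteLeafOfPosition

/-! ### The displayed hypothesis (section variable): hKatoPosʷ = «Kato-only ∧ POS», all tower rows -/

section OfPosition

variable (hKatoPos :
    ∀ (W : WeierstrassCurve ℚ) [W.IsElliptic] [W.IsGloballyMinimal]
        [ContinuousSMul ℤ_[3] (W.tateModule 3)] [Module.Free ℤ_[3] (W.tateModule 3)]
        [Module.Finite ℤ_[3] (W.tateModule 3)],
        (∀ m : ℕ, W.HasSurjectiveModNGaloisRep (3 ^ m : ℕ)) →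
        ∀ {N : ℕ} [NeZero N] (P : ModularParametrizationData W N), N = W.conductorNorm ℤ →
          (∀ z ∈ P.L.lattice, ∃ w ∈ periodLattice P.f, z = P.c * w) →
          haveI : Fact (((3 : ℕ) : 𝓞 ℚ) ∈ ((Rat.HeightOneSpectrum.primesEquiv (R := 𝓞 ℚ)).symm ⟨3, Fact.out⟩).asIdeal) :=
            ⟨(natCast_mem_asIdeal_iff_eq_primesEquiv_symm _ Nat.prime_three).mpr rfl⟩
          letI := valuativeRelPlace ((Rat.HeightOneSpectrum.primesEquiv (R := 𝓞 ℚ)).symm ⟨3, Fact.out⟩)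
          letI := topologicalSpacePlace ((Rat.HeightOneSpectrum.primesEquiv (R := 𝓞 ℚ)).symm ⟨3, Fact.out⟩)
          haveI := isNonarchimedeanLocalField_place ((Rat.HeightOneSpectrum.primesEquiv (R := 𝓞 ℚ)).symm ⟨3, Fact.out⟩)
          haveI := charZero_place ((Rat.HeightOneSpectrum.primesEquiv (R := 𝓞 ℚ)).symm ⟨3, Fact.out⟩)
          letI := padicAlgebraPlace 3 ((Rat.HeightOneSpectrum.primesEquiv (R := 𝓞 ℚ)).symm ⟨3, Fact.out⟩)
          haveI := fact_not_isUnit_place 3 ((Rat.HeightOneSpectrum.primesEquiv (R := 𝓞 ℚ)).symm ⟨3, Fact.out⟩)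
          haveI := isAdicComplete_place 3 ((Rat.HeightOneSpectrum.primesEquiv (R := 𝓞 ℚ)).symm ⟨3, Fact.out⟩)
          ∃ (d : LocalNeronLineAt W 3 ((Rat.HeightOneSpectrum.primesEquiv (R := 𝓞 ℚ)).symm ⟨3, Fact.out⟩)),
          ∃ (ι : (n : ℕ) → (CyclotomicField n ℚ →+* ℂ)) (κK : ℝ)
            (Λ : ∀ (k' : ℕ) (r : Finset (HeightOneSpectrum (𝓞 ℚ))),
              H1 (tateRep W 3) (cycSubgroup 3 k' r) →ₗ[ℤ_[3]]
                ℚ_[3] ⊗[ℚ] CyclotomicField (cycLevel 3 k' r) ℚ),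
            κK ≠ 0 ∧
            (∃ u : ℚ, (u : ℝ) = κK ∧
              ∀ (hinj : (bdRPeriodRingData (valuation_place_lt_one 3 ((Rat.HeightOneSpectrum.primesEquiv (R := 𝓞 ℚ)).symm ⟨3, Fact.out⟩))).CupLogInjective (logCyclotomic 3)
              (localRationalTateRep W 3 (galRestrictPlace ((Rat.HeightOneSpectrum.primesEquiv (R := 𝓞 ℚ)).symm ⟨3, Fact.out⟩))))
              (hex : ∀ z : contOneCocycles (localRationalTateRep W 3 (galRestrictPlace ((Rat.HeightOneSpectrum.primesEquiv (R := 𝓞 ℚ)).symm ⟨3, Fact.out⟩))).toTopRep,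
              (bdRPeriodRingData (valuation_place_lt_one 3 ((Rat.HeightOneSpectrum.primesEquiv (R := 𝓞 ℚ)).symm ⟨3, Fact.out⟩))).HasDualExp (logCyclotomic 3)
              (localRationalTateRep W 3 (galRestrictPlace ((Rat.HeightOneSpectrum.primesEquiv (R := 𝓞 ℚ)).symm ⟨3, Fact.out⟩))) fun σ => z.1 σ)
                (e : ((Rat.HeightOneSpectrum.primesEquiv (R := 𝓞 ℚ)).symm ⟨3, Fact.out⟩).adicCompletion ℚ) (he : e ≠ 0),
                (∀ a : ℚ_[3], (∃ y, (expStarOmegaPadicAt (d.smul e he) hinj hex (((Padic.adicCompletionEquiv (𝓞 ℚ) ⟨3, Fact.out⟩).symm : (((Rat.HeightOneSpectrum.primesEquiv (R := 𝓞 ℚ)).symm ⟨3, Fact.out⟩).adicCompletion ℚ) →+* ℚ_[3]))) y = a) ↔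
                  ∀ Q : (W.baseChange ℚ_[3]).toAffine.Point, ‖a * padicLog (W.baseChange ℚ_[3]) Q‖ ≤ 1) →
                padicValRat 3 u = ((((Padic.adicCompletionEquiv (𝓞 ℚ) ⟨3, Fact.out⟩).symm : (((Rat.HeightOneSpectrum.primesEquiv (R := 𝓞 ℚ)).symm ⟨3, Fact.out⟩).adicCompletion ℚ) →+* ℚ_[3])) e).valuation) ∧
            (∀ (j : ℕ) (r : Finset (HeightOneSpectrum (𝓞 ℚ)))
              (Ψ : ℚ_[3] ⊗[ℚ] CyclotomicField (cycLevel 3 0 r) ℚ ≃ₐ[ℚ]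
                (Π w : ((Rat.HeightOneSpectrum.primesEquiv (R := 𝓞 ℚ)).symm ⟨3, Fact.out⟩).Extension
                  (𝓞 (CyclotomicField (cycLevel 3 0 r) ℚ)), w.1.adicCompletion (CyclotomicField (cycLevel 3 0 r) ℚ)))
              (hΨ : ∀ (s : ℚ_[3]) (x : CyclotomicField (cycLevel 3 0 r) ℚ)
                (w : ((Rat.HeightOneSpectrum.primesEquiv (R := 𝓞 ℚ)).symm ⟨3, Fact.out⟩).Extension
                  (𝓞 (CyclotomicField (cycLevel 3 0 r) ℚ))),
                Ψ (s ⊗ₜ[ℚ] x) w =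
                  algebraMap (CyclotomicField (cycLevel 3 0 r) ℚ) (w.1.adicCompletion (CyclotomicField (cycLevel 3 0 r) ℚ)) x *
                  algebraMap (((Rat.HeightOneSpectrum.primesEquiv (R := 𝓞 ℚ)).symm ⟨3, Fact.out⟩).adicCompletion ℚ)
                    (w.1.adicCompletion (CyclotomicField (cycLevel 3 0 r) ℚ)) ((Padic.adicCompletionEquiv (𝓞 ℚ) ⟨3, Fact.out⟩) s)),
              ∃ (w₀ : ((Rat.HeightOneSpectrum.primesEquiv (R := 𝓞 ℚ)).symm ⟨3, Fact.out⟩).Extension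
                  (𝓞 (CyclotomicField (cycLevel 3 0 r) ℚ)))
                (g : ((Rat.HeightOneSpectrum.primesEquiv (R := 𝓞 ℚ)).symm ⟨3, Fact.out⟩).Extension
                  (𝓞 (CyclotomicField (cycLevel 3 0 r) ℚ)) → absoluteGaloisGroup ℚ)
                (hg : ∀ w : ((Rat.HeightOneSpectrum.primesEquiv (R := 𝓞 ℚ)).symm ⟨3, Fact.out⟩).Extension
                  (𝓞 (CyclotomicField (cycLevel 3 0 r) ℚ)),
                  sigma (cycLevel 3 0 r) (modNCyclotomicCharacter ℚ (cycLevel 3 0 r) (g w)) • w.1 = w₀.1),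
                  letI := LocalField.charZero_adicCompletion w₀.1
                  letI := LocalField.adicCompletionPadicAlgebra w₀.1 3 (three_mem_asIdeal_extension _ w₀)
                  haveI : Fact (¬ IsUnit ((3 : ℕ) : integerC (w₀.1.adicCompletion (CyclotomicField (cycLevel 3 0 r) ℚ)))) :=
                    ⟨not_isUnit_natCast_integerC (LocalField.valuation_adicCompletion_natCast_lt_one w₀.1 3 (three_mem_asIdeal_extension _ w₀))⟩
                  haveI := isAdicComplete_integerC_natCast (LocalField.valuation_adicCompletion_natCast_lt_one w₀.1 3 (three_mem_asIdeal_extension _ w₀))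
                  ∃ (dw : LocalNeronLine W (LocalField.valuation_adicCompletion_natCast_lt_one w₀.1 3 (three_mem_asIdeal_extension _ w₀))
                    ((galRestrictPlace ((Rat.HeightOneSpectrum.primesEquiv (R := 𝓞 ℚ)).symm ⟨3, Fact.out⟩)).comp
                      (absGaloisRestrict (((Rat.HeightOneSpectrum.primesEquiv (R := 𝓞 ℚ)).symm ⟨3, Fact.out⟩).adicCompletion ℚ) (w₀.1.adicCompletion (CyclotomicField (cycLevel 3 0 r) ℚ)))))
                    (hinjw : (bdRPeriodRingData (LocalField.valuation_adicCompletion_natCast_lt_one w₀.1 3 (three_mem_asIdeal_extension _ w₀))).CupLogInjective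
                    (logCyclotomic 3) (localRationalTateRep W 3 ((galRestrictPlace ((Rat.HeightOneSpectrum.primesEquiv (R := 𝓞 ℚ)).symm ⟨3, Fact.out⟩)).comp
                      (absGaloisRestrict (((Rat.HeightOneSpectrum.primesEquiv (R := 𝓞 ℚ)).symm ⟨3, Fact.out⟩).adicCompletion ℚ) (w₀.1.adicCompletion (CyclotomicField (cycLevel 3 0 r) ℚ))))))
                    (hexw : ∀ z : contOneCocycles (localRationalTateRep W 3 ((galRestrictPlace ((Rat.HeightOneSpectrum.primesEquiv (R := 𝓞 ℚ)).symm ⟨3, Fact.out⟩)).comp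
                      (absGaloisRestrict (((Rat.HeightOneSpectrum.primesEquiv (R := 𝓞 ℚ)).symm ⟨3, Fact.out⟩).adicCompletion ℚ) (w₀.1.adicCompletion (CyclotomicField (cycLevel 3 0 r) ℚ))))).toTopRep,
                    (bdRPeriodRingData (LocalField.valuation_adicCompletion_natCast_lt_one w₀.1 3 (three_mem_asIdeal_extension _ w₀))).HasDualExp
                      (logCyclotomic 3) (localRationalTateRep W 3 ((galRestrictPlace ((Rat.HeightOneSpectrum.primesEquiv (R := 𝓞 ℚ)).symm ⟨3, Fact.out⟩)).comp
                      (absGaloisRestrict (((Rat.HeightOneSpectrum.primesEquiv (R := 𝓞 ℚ)).symm ⟨3, Fact.out⟩).adicCompletion ℚ) (w₀.1.adicCompletion (CyclotomicField (cycLevel 3 0 r) ℚ))))) fun σ => z.1 σ),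
                    (∀ (h : (tateLocalRep W 3 (Sum.inr ((Rat.HeightOneSpectrum.primesEquiv (R := 𝓞 ℚ)).symm ⟨3, Fact.out⟩))).cohomology 1),
                    (expStarOmegaHom (LocalField.valuation_adicCompletion_natCast_lt_one w₀.1 3 (three_mem_asIdeal_extension _ w₀))
                      ((galRestrictPlace ((Rat.HeightOneSpectrum.primesEquiv (R := 𝓞 ℚ)).symm ⟨3, Fact.out⟩)).comp
                      (absGaloisRestrict (((Rat.HeightOneSpectrum.primesEquiv (R := 𝓞 ℚ)).symm ⟨3, Fact.out⟩).adicCompletion ℚ) (w₀.1.adicCompletion (CyclotomicField (cycLevel 3 0 r) ℚ)))) dw hinjw hexw)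
                      (ContinuousRep.cohomologyRes (tateLocalRep W 3 (Sum.inr ((Rat.HeightOneSpectrum.primesEquiv (R := 𝓞 ℚ)).symm ⟨3, Fact.out⟩)))
                        (absGaloisRestrict (((Rat.HeightOneSpectrum.primesEquiv (R := 𝓞 ℚ)).symm ⟨3, Fact.out⟩).adicCompletion ℚ) (w₀.1.adicCompletion (CyclotomicField (cycLevel 3 0 r) ℚ))) 1 h) =
                    algebraMap (((Rat.HeightOneSpectrum.primesEquiv (R := 𝓞 ℚ)).symm ⟨3, Fact.out⟩).adicCompletion ℚ) (w₀.1.adicCompletion (CyclotomicField (cycLevel 3 0 r) ℚ)) (expStarOmegaAt d h)) ∧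
                    (∀ (w : ((Rat.HeightOneSpectrum.primesEquiv (R := 𝓞 ℚ)).symm ⟨3, Fact.out⟩).Extension
                      (𝓞 (CyclotomicField (cycLevel 3 0 r) ℚ)))
                    (y : H1 (tateRep W 3) (cycSubgroup 3 0 r))
                    (φ'' : contOneCocycles (subgroupRep (tateRep W 3).toTopRep (cycSubgroup 3 0 r)))
                    (ψT : contOneCocycles ((tateLocalRep W 3 (Sum.inr ((Rat.HeightOneSpectrum.primesEquiv (R := 𝓞 ℚ)).symm ⟨3, Fact.out⟩))).restrict
                      (absGaloisRestrict (((Rat.HeightOneSpectrum.primesEquiv (R := 𝓞 ℚ)).symm ⟨3, Fact.out⟩).adicCompletion ℚ) (w₀.1.adicCompletion (CyclotomicField (cycLevel 3 0 r) ℚ)))).toTopRep),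
                    oneCocycleClass _ φ'' = conjMap (tateRep W 3).toTopRep (cycSubgroup 3 0 r) (g w) 1 y →
                    (∀ σ, ψT.1 σ = φ''.1 ⟨absGaloisRestrictTower ℚ (((Rat.HeightOneSpectrum.primesEquiv (R := 𝓞 ℚ)).symm ⟨3, Fact.out⟩).adicCompletion ℚ) (w₀.1.adicCompletion (CyclotomicField (cycLevel 3 0 r) ℚ)) σ,
                      absGaloisRestrictTower_adicCompletion_mem_cycSubgroup r w₀ σ⟩) →
                    Ψ (Λ 0 r y) w = galAdicCompletionMap
                      (sigma (cycLevel 3 0 r) (modNCyclotomicCharacter ℚ (cycLevel 3 0 r) (g w)))⁻¹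
                      (inv_smul_eq_of_smul_eq (hg w))
                      ((expStarOmegaHom (LocalField.valuation_adicCompletion_natCast_lt_one w₀.1 3 (three_mem_asIdeal_extension _ w₀))
                      ((galRestrictPlace ((Rat.HeightOneSpectrum.primesEquiv (R := 𝓞 ℚ)).symm ⟨3, Fact.out⟩)).comp
                      (absGaloisRestrict (((Rat.HeightOneSpectrum.primesEquiv (R := 𝓞 ℚ)).symm ⟨3, Fact.out⟩).adicCompletion ℚ) (w₀.1.adicCompletion (CyclotomicField (cycLevel 3 0 r) ℚ)))) dw hinjw hexw) (oneCocycleClass _ ψT)))) ∧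
            ∀ (c d a : ℤ) (A : ℕ), 0 < A → Int.gcd c (6 * 3 * A) = 1 → Int.gcd d (6 * 3 * N) = 1 →
              ∃ (z : ∀ (k' : ℕ) (r : (cyclotomicLevelsRat 3 (badPlaces c d A N)).Ideals),
                    H1 (tateRep W 3) ((cyclotomicLevelsRat 3 (badPlaces c d A N)).level k' r.1))
                (x : ∀ (k' : ℕ) (r : (cyclotomicLevelsRat 3 (badPlaces c d A N)).Ideals),
                    CyclotomicField (cycLevel 3 k' r.1) ℚ),
                ZetaBody W 3 P.f ι κK Λ c d a A z x)

include hKatoPos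

/-- **Crux 19077 `ShallowEqDeepAtTorsionFree` BY NAME ⟸ the four route leaves ∧ (S5a) ∧ (S5b) ∧ (S5b-tower) ∧ (P123) ∧ (DR) ∧
hKatoPosʷ ∧ item 20398** — NO crux-19560 hypothesis: 19560 is w2-acc4's `katoKuriharaPortThreeShared_of_facts_of_katoPos` at
hKatoPosʷ restricted to the Kato stratum.  CONDITIONAL; nothing booked; 19077 stays OPEN.
[cite: Kim2025RefinedTNC, Thm 1.2] [cite: Sakamoto2024, Thm. 4.4 (p. 926)] [cite: MazurRubin2004, Thm. 4.4.1 and Thm. 5.2.12]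
[cite: Kato2004Asterisque, (8.1.3) (p. 180), Prop. 8.12 (p. 186), §9.4 and Thm. 9.7 (pp. 188–189), Thm. 6.6 (1) (p. 163), Ex. 13.3 (pp. 224–225)]
[cite: Kato1993LNM1553, Ch. II §1.2.4, Prop. 1.2.3 and Thm. 1.4.1] [cite: BlochKato1990, §3 Prop. 3.8, Ex. 3.11] [cite: Carayol1986] -/
theorem shallowEqDeepAtTorsionFree_of_katoPos_of_cites
    (hSak : SakamotoKolyvaginThree) (hGZK : RankEqAnalyticRankLeOne) (hPT : PoitouTateSelmerDuality)
    (hlev : CarayolLevelEqConductor)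
    (hP : cupLogInjective_and_hasDualExp_of_isDeRham) (hDR : isDeRham_restrictedRationalTateRep)
    (hS : expStarCoord_eq_zero_iff_kummer) (hT : exists_smul_range_expStarCoord_iff_trace_log)
    (hT₂ : exists_smul_range_expStarCoord_tower_iff_trace_log)
    (h₃ : FineKatoTwoExpDefectThree) : ShallowEqDeepAtTorsionFree :=
  shallowEqDeepAtTorsionFree_of_katoPos_of_facts hKatoPos hSak hGZK hPT hlev
    (katoKuriharaPortThreeShared_of_facts_of_katoPos hS hT₂ hP hDR hT
      (by
        intro W _ _ _ _ _ htow _ _ _ N _ P hN hlat _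
        exact hKatoPos W htow P hN hlat))
    hP hDR hT hS hT₂ h₃

/-- **The ROUTE LEAF `N11.KimAtThreeRankZeroPUB` BY NAME ⟸ the four route leaves ∧ (S5a) ∧ (S5b) ∧ (S5b-tower) ∧ (P123) ∧ (DR) ∧ the
Kato Literature fact `Kato2004.exists_eulerSystem_definedExpStar_values` ∧ hKatoPosʷ ∧ item 20398** — the route's deciding theorem
`closes` on w2-c2 / w2-c3's cite-only deep cruxes, §1 and kim3's assembly `kimAtThreeRankZeroPUB_of_inputs`.  CONDITIONAL on every displayed hypothesis; closes the
rung-W2 leaf only modulo them; BSD is NOT proved by this. [cite: Kim2025RefinedTNC, Thm 1.1, Thm 1.2]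
[cite: Kato2004Asterisque, (8.1.3) (p. 180), Prop. 8.12 (p. 186), §9.4 and Thm. 9.7 (pp. 188–189), Thm. 6.6 (1) (p. 163), Ex. 13.3 (pp. 224–225)]
[cite: Sakamoto2024, Thm. 4.4 (p. 926)] [cite: MazurRubin2004, Thm. 4.4.1 and Thm. 5.2.12] [cite: Carayol1986]
[cite: Kato1993LNM1553, Ch. II §1.2.4, Prop. 1.2.3 and Thm. 1.4.1] [cite: BlochKato1990, §3 Prop. 3.8, Ex. 3.11] -/
theorem kimAtThreeRankZeroPUB_of_katoPos_of_lit_of_cites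
    (hLit : Kato2004.exists_eulerSystem_definedExpStar_values)
    (hSak : SakamotoKolyvaginThree) (hGZK : RankEqAnalyticRankLeOne) (hPT : PoitouTateSelmerDuality)
    (hlev : CarayolLevelEqConductor)
    (hP : cupLogInjective_and_hasDualExp_of_isDeRham) (hDR : isDeRham_restrictedRationalTateRep)
    (hS : expStarCoord_eq_zero_iff_kummer) (hT : exists_smul_range_expStarCoord_iff_trace_log)
    (hT₂ : exists_smul_range_expStarCoord_tower_iff_trace_log)
    (h₃ : FineKatoTwoExpDefectThree) :
    Summit.BirchSwinnertonDyer.Rank1Residual.Additive.N11.KimAtThreeRankZeroPUB :=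
  closes (deepLower_and_deepUpper_of_lit_of_facts hLit hSak hGZK hPT hlev hP hDR hS hT hT₂).1
    (deepLower_and_deepUpper_of_lit_of_facts hLit hSak hGZK hPT hlev hP hDR hS hT hT₂).2
    (shallowEqDeepAtTorsionFree_of_katoPos_of_cites hKatoPos hSak hGZK hPT hlev hP hDR hS hT hT₂ h₃)
    (fun h₁ h₂ h₃ => KimAtThreeKolyvaginInputs.kimAtThreeRankZeroPUB_of_inputs h₁ h₂ h₃)

/-! ### Appended (same session, after kim3 g17's p542762 `(S5b-tower) ⇒ (S5b)`): the FOUR-cite-fact forms -/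

/-- **Crux 19077 BY NAME ⟸ the four route leaves ∧ FOUR cite facts {(S5a), (S5b-tower), (P123), (DR)} ∧ hKatoPosʷ ∧ item 20398** —
`shallowEqDeepAtTorsionFree_of_katoPos_of_cites` with (S5b) := kim3 g17's theorem
`PAdicHodge.exists_smul_range_expStarCoord_iff_trace_log_of_tower` at (S5b-tower).  CONDITIONAL; nothing booked.
[cite: Kim2025RefinedTNC, Thm 1.2] [cite: Kato2004Asterisque, §9.4 and Thm. 9.7 (pp. 188–189), Ex. 13.3 (pp. 224–225)]
[cite: Kato1993LNM1553, Ch. II §1.2.4, Prop. 1.2.3 and Thm. 1.4.1] [cite: BlochKato1990, §3 Prop. 3.8, Ex. 3.11]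
[cite: Sakamoto2024, Thm. 4.4 (p. 926)] [cite: MazurRubin2004, Thm. 4.4.1 and Thm. 5.2.12] [cite: Carayol1986] -/
theorem shallowEqDeepAtTorsionFree_of_katoPos_of_four_cites
    (hSak : SakamotoKolyvaginThree) (hGZK : RankEqAnalyticRankLeOne) (hPT : PoitouTateSelmerDuality)
    (hlev : CarayolLevelEqConductor)
    (hP : cupLogInjective_and_hasDualExp_of_isDeRham) (hDR : isDeRham_restrictedRationalTateRep)
    (hS : expStarCoord_eq_zero_iff_kummer) (hT₂ : exists_smul_range_expStarCoord_tower_iff_trace_log)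
    (h₃ : FineKatoTwoExpDefectThree) : ShallowEqDeepAtTorsionFree :=
  shallowEqDeepAtTorsionFree_of_katoPos_of_cites hKatoPos hSak hGZK hPT hlev hP hDR hS
    (exists_smul_range_expStarCoord_iff_trace_log_of_tower hT₂) hT₂ h₃

/-- **The ROUTE LEAF `N11.KimAtThreeRankZeroPUB` BY NAME ⟸ the four route leaves ∧ FOUR cite facts {(S5a), (S5b-tower), (P123), (DR)}
∧ the Kato Literature fact ∧ hKatoPosʷ ∧ item 20398** ((S5b) by kim3 g17's `exists_smul_range_expStarCoord_iff_trace_log_of_tower`).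
CONDITIONAL on every displayed hypothesis; closes the rung-W2 leaf only modulo them; BSD is NOT proved by this.
[cite: Kim2025RefinedTNC, Thm 1.1, Thm 1.2] [cite: Kato2004Asterisque, (8.1.3) (p. 180), Prop. 8.12 (p. 186), §9.4 and Thm. 9.7 (pp. 188–189), Thm. 6.6 (1) (p. 163), Ex. 13.3 (pp. 224–225)]
[cite: Kato1993LNM1553, Ch. II §1.2.4, Prop. 1.2.3 and Thm. 1.4.1] [cite: BlochKato1990, §3 Prop. 3.8, Ex. 3.11]
[cite: Sakamoto2024, Thm. 4.4 (p. 926)] [cite: MazurRubin2004, Thm. 4.4.1 and Thm. 5.2.12] [cite: Carayol1986] -/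
theorem kimAtThreeRankZeroPUB_of_katoPos_of_lit_of_four_cites
    (hLit : Kato2004.exists_eulerSystem_definedExpStar_values)
    (hSak : SakamotoKolyvaginThree) (hGZK : RankEqAnalyticRankLeOne) (hPT : PoitouTateSelmerDuality)
    (hlev : CarayolLevelEqConductor)
    (hP : cupLogInjective_and_hasDualExp_of_isDeRham) (hDR : isDeRham_restrictedRationalTateRep)
    (hS : expStarCoord_eq_zero_iff_kummer) (hT₂ : exists_smul_range_expStarCoord_tower_iff_trace_log)
    (h₃ : FineKatoTwoExpDefectThree) :
    Summit.BirchSwinnertonDyer.Rank1Residual.Additive.N11.KimAtThreeRankZeroPUB :=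
  kimAtThreeRankZeroPUB_of_katoPos_of_lit_of_cites hKatoPos hLit hSak hGZK hPT hlev hP hDR hS
    (exists_smul_range_expStarCoord_iff_trace_log_of_tower hT₂) hT₂ h₃

end OfPosition

end Summit.BirchSwinnertonDyer.BirchSwinnertonDyer.Theorems.KimAtThreeShallowEqDeepRouteLeafOfPosition

end
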